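import Summits.AnomalousDissipation.AnomalousDissipation.Theses.EulerLimit

/-!
# Line `tight` — crux `EulerLimit.EulerlimitThesisV2` (stmt-AnomalousDissipation-0511)

Crux-strategist line (seat `planner-cstrat-stmt-AnomalousDissipation-0511-s1-0`, 2026-08-17).
Card: `Cruxes/EulerlimitThesisV2/Lines/tight.md`; census: `Cruxes/EulerlimitThesisV2/STRATEGY-CENSUS.md`.

The crux `X = EulerlimitThesisV2` (thesis of route EulerLimit): SOME steady smooth divergence-free
mean-zero force `f`, period `τ > 0`, a `τ`-periodic global weak solution `u` of FORCED EULER with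
positive period input `∫₀^τ∫⟪f,u⟫ > 0`, realised as the strong `L³((0,τ)×𝕋³)` limit (junk-free
nested `lintegral` clause) of `τ`-periodic CLASSICAL Navier–Stokes solutions `us j` with the SAME
force and `ν j → 0`.

## The line: KOLMOGOROV–RIESZ TIGHTNESS (three registered stubs)

`X` is read from the Navier–Stokes side and the limit object is ELIMINATED.  By the
Kolmogorov–M. Riesz–Fréchet criterion on the compact group `(ℝ/τℤ) × 𝕋³`, a bounded family in
`L³((0,τ)×𝕋³)` has an `L³`-convergent subsequence iff it is `L³`-equicontinuous under space–time
translations; and for a same-force classical family every clause `X` asks of the limit (periodic,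
weak forced Euler with datum, positive input) is then an OUTPUT of a limit-passage theorem.  Hence

  `X ⟺ H`,  `H` := "some steady smooth `f` drives, for viscosities `ν j → 0`, `τ`-periodic classical
  flows with bounded energy, bounded `L³` mass, period input `≥ c > 0`, and NO ESCAPE OF `L³`-MASS TO
  VANISHING SPACE–TIME SCALES (uniform `L³`-modulus of continuity)"

(`⟸` = stubs 2 + 3 below; `⟹` = necessity half of Kolmogorov–Riesz + eventual input floor, a remark
not needed by the skeleton).  `H` (stub 1) is a statement about a-priori properties of smooth NS
flows only — no Euler object, no datum, no defect, no convergence clause — and it exhibits EXACTLY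
the surplus of `X` over the periodic-classical zeroth law: uniform `L³`-tightness (K41: the third-order
absolute structure function obeys `S₃(r) ≲ r^{ζ₃}` with `ζ₃ = 1 > 0` uniformly in `Re`).

* `stub_loudTightFamily` (HEART, XL, open; summit-strength, `⟺ X`): `H` above.
* `stub_kolmogorovRieszPeriodicSlab` (M–L, provable now; pure functional analysis): a family of
  jointly smooth `τ`-periodic fields, bounded in `L³((0,τ)×𝕋³)` and `L³`-equicontinuous under
  space–time translations uniformly, has a subsequence converging in `L³((0,τ)×𝕋³)` to a
  `τ`-periodic jointly measurable field (Kolmogorov–Riesz sufficiency; tree: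
  `Literature.Analysis.FunctionSpaces.exists_finset_eLpNorm_sub_lt_of_translate` after a periodic
  cut-off lift to `ℝ × ℝ³`, completeness of `L³`, a.e.-convergent subsequence for the representative).
* `stub_periodicInviscidLimit` (L–XL, provable now; PDE limit passage): if `τ`-periodic classical
  solutions of `NS(ν_j, f)` (steady smooth `f`, `ν_j → 0`) with bounded energy and period input `≥ c > 0`
  converge in `L³((0,τ)×𝕋³)` to a `τ`-periodic measurable `w`, then along a subsequence they converge
  to a `τ`-periodic `u` (`= w` off the null set of times `τℤ`, where `u` is the weak `L²` limit of the
  data `us_{φ j}(0)`) which is a weak solution of forced Euler on every `[0,T)` with datum `u 0` and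
  has period input `> 0` (forced, periodic, with-datum version of the PROVED tree theorem
  `Literature.Analysis.FluidPDE.Torus.isWeakEulerSolutionOn_of_inviscidLimit`, Drivas–Eyink Thm 2(ii) /
  DiPerna–Majda §1 / Duchon–Robert Prop. 4).

Composition `EulerlimitThesisV2_of` (sorry-free): family from stub 1; `(w, φ₁)` from stub 2 applied to
`us` (smoothness from `IsClassicalNSSolutionOn.smooth_velocity`); stub 3 applied to the reindexed
family `us ∘ φ₁` gives `(u, φ₂)`; witness `(f, τ, u, ν ∘ φ₁ ∘ φ₂, us ∘ φ₁ ∘ φ₂, ps ∘ φ₁ ∘ φ₂)`.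

## Disproof / negatives honoured
No `Cruxes/EulerlimitThesisV2/Disproof.lean` exists (`ledger crux ls stmt-AnomalousDissipation-0511`,
2026-08-17: no workfiles; this is the directory's first line).  `ledger negatives --problem
AnomalousDissipation` (6 statements: 14324, 0204, 13037, 2979, 2984, 2859): none equal or trivially
equivalent to a stub.  Barriers: see the card (`BuckmasterVicol2019_thm13` named not evaded — stub 1
asks for CLASSICAL approximants; `DrivasEyink2019_lemma1` respected — tightness is demanded in `L³`
only, witnesses must stay unbounded in `L³_t B^{s}_{3,∞}` for `s > 1/3`;
`BrueDeLellis2023_noAnomaly_beforeEulerSingularity` respected — the limit cannot be Lipschitz;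
`BardosTitiWiedemann2012_thm5` — witnesses genuinely 3-D).
-/

noncomputable section

-- D-0017: single-problem summit ⇒ the duplicated namespace segment is by design.
set_option linter.dupNamespace false

open Filter Set MeasureTheory

namespace Summit.AnomalousDissipation.AnomalousDissipation.Cruxes.EulerlimitThesisV2.Tight

open Summit.AnomalousDissipation.AnomalousDissipation.Theses.EulerLimit

/-- The physical flat unit torus `𝕋³` (local notation). -/
local notation "𝕋³" => UnitAddTorus (Fin 3)
/-- Velocity values (local notation). -/
local notation "E³" => EuclideanSpace ℝ (Fin 3)

/-! ## §1 Registered stubs (the only `sorry`s of the file) -/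

/-- **Stub 1 — LOUD `L³`-TIGHT PERIODIC FAMILY (the `ν → 0` physics; XL, open; `⟺` the crux).**
Some steady smooth divergence-free mean-zero force `f`, a period `τ > 0`, a floor `c > 0`, bounds
`E`, `M`, positive viscosities `ν_j → 0` and `τ`-periodic CLASSICAL solutions `(us j, ps j)` of
`NS(ν_j, f)` on all of `ℝ × 𝕋³` such that, uniformly in `j`: energy `∫‖us j t‖² ≤ E` for all `t`,
`L³` mass `∫₀^τ∫‖us j‖³ ≤ M`, period input `∫₀^τ∫⟪f, us j(t)⟫ ≥ c`, and the family is
`L³((0,τ)×𝕋³)`-EQUICONTINUOUS under space–time translations `(t, x) ↦ (t + s, x + h)`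
(no `L³`-mass escapes to vanishing scales as `ν → 0`).  No limit object occurs.
Why it might fail / sources: see the card. -/
theorem stub_loudTightFamily :
    ∃ f : 𝕋³ → E³, Literature.Analysis.FunctionSpaces.Torus.IsSmooth f ∧
      Literature.Analysis.FunctionSpaces.Torus.IsDivFree f ∧
      Literature.Analysis.FunctionSpaces.Torus.HasZeroMean f ∧
      ∃ (τ c E M : ℝ), 0 < τ ∧ 0 < c ∧
        ∃ (ν : ℕ → ℝ) (us : ℕ → ℝ → 𝕋³ → E³) (ps : ℕ → ℝ → 𝕋³ → ℝ),
          (∀ j, 0 < ν j) ∧ Filter.Tendsto ν Filter.atTop (nhds 0) ∧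
          (∀ j, Literature.Analysis.FunctionSpaces.Torus.IsClassicalNSSolutionOn Set.univ (ν j) (fun _ => f)
              (us j) (ps j) ∧ Function.Periodic (us j) τ) ∧
          (∀ j t, ∫ x, ‖us j t x‖ ^ 2 ≤ E) ∧
          (∀ j, ∫⁻ t in Set.Ioo 0 τ, ∫⁻ x, ‖us j t x‖ₑ ^ 3 ≤ ENNReal.ofReal M) ∧
          (∀ j, c ≤ ∫ t in (0 : ℝ)..τ, MeasureTheory.integral MeasureTheory.volume
              (fun x => inner ℝ (f x) (us j t x))) ∧
          (∀ ε : ℝ, 0 < ε → ∃ δ : ℝ, 0 < δ ∧ ∀ (j : ℕ) (s : ℝ) (h : 𝕋³), |s| ≤ δ → ‖h‖ ≤ δ →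
              ∫⁻ t in Set.Ioo 0 τ, ∫⁻ x, ‖us j (t + s) (x + h) - us j t x‖ₑ ^ 3 ≤ ENNReal.ofReal ε) := by
  sorry

/-- **Stub 2 — KOLMOGOROV–RIESZ ON THE PERIODIC SLAB (M–L, provable now; pure functional analysis).**
A family of jointly smooth, `τ`-periodic-in-time fields `v j : ℝ → 𝕋³ → E³`, bounded in
`L³((0,τ)×𝕋³)` and `L³`-equicontinuous under space–time translations uniformly in `j`, has a
subsequence converging in `L³((0,τ)×𝕋³)` (junk-free nested `lintegral`) to a `τ`-periodic field `w`
whose space–time lift is a.e.-strongly measurable on `(0,τ) × ℝ³`.  (Kolmogorov–M. Riesz–Fréchet,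
sufficiency, on the compact group `(ℝ/τℤ) × 𝕋³`: tree `exists_finset_eLpNorm_sub_lt_of_translate`
after a smooth periodic cut-off lift; total boundedness + completeness of `L³`; an a.e.-convergent
sub-subsequence supplies the pointwise representative, extended `τ`-periodically.)
Why it might fail / sources: see the card. -/
theorem stub_kolmogorovRieszPeriodicSlab :
    ∀ (τ M : ℝ) (v : ℕ → ℝ → 𝕋³ → E³), 0 < τ →
      (∀ j, Literature.Analysis.FunctionSpaces.Torus.IsSmoothSpaceTimeOn Set.univ (v j)) →
      (∀ j, Function.Periodic (v j) τ) →
      (∀ j, ∫⁻ t in Set.Ioo 0 τ, ∫⁻ x, ‖v j t x‖ₑ ^ 3 ≤ ENNReal.ofReal M) →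
      (∀ ε : ℝ, 0 < ε → ∃ δ : ℝ, 0 < δ ∧ ∀ (j : ℕ) (s : ℝ) (h : 𝕋³), |s| ≤ δ → ‖h‖ ≤ δ →
          ∫⁻ t in Set.Ioo 0 τ, ∫⁻ x, ‖v j (t + s) (x + h) - v j t x‖ₑ ^ 3 ≤ ENNReal.ofReal ε) →
      ∃ (w : ℝ → 𝕋³ → E³) (φ : ℕ → ℕ), StrictMono φ ∧ Function.Periodic w τ ∧
        MeasureTheory.AEStronglyMeasurable (Literature.Analysis.FunctionSpaces.Torus.stLift w)
          (MeasureTheory.volume.restrict (Set.Ioo 0 τ ×ˢ Set.univ)) ∧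
        Filter.Tendsto (fun j => ∫⁻ t in Set.Ioo 0 τ, ∫⁻ x, ‖v (φ j) t x - w t x‖ₑ ^ 3)
          Filter.atTop (nhds 0) := by
  sorry

/-- **Stub 3 — PERIODIC SAME-FORCE INVISCID LIMIT PASSAGE, FORCED AND WITH DATUM (L–XL, provable now).**
Let `f` be steady, smooth, divergence free; `τ > 0`, `c > 0`; `ν_j > 0`, `ν_j → 0`; `(us j, ps j)`
`τ`-periodic classical solutions of `NS(ν_j, f)` on `ℝ × 𝕋³` with energies `∫‖us j t‖² ≤ E` and
period inputs `≥ c`; and suppose `us j → w` in `L³((0,τ)×𝕋³)` for a `τ`-periodic measurable `w`.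
Then along a subsequence `φ` the family converges in `L³((0,τ)×𝕋³)` to a `τ`-periodic `u` — equal
to `w` off the null set of times `τℤ`, where `u` is redefined as a weak `L²` limit of the data
`us (φ j) 0` — which is a weak solution of FORCED EULER on every `[0,T)` with datum `u 0`
(`Torus.IsWeakNSSolutionForcedOn T 0 (fun _ => f) (u 0) u`) and has period input `∫₀^τ∫⟪f,u⟫ > 0`.
(Periodicity turns `L³((0,τ))` into `L³((0,T))` convergence for every `T`; classical ⟹ weak with
datum for the approximants; the quadratic term passes to the limit by strong `L³ ⊂ L²` convergence,
the viscous term is `O(ν_j)`, the datum term by weak `L²` convergence of `us (φ j) 0` against the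
fixed `ψ 0`; a.e. weak divergence-freeness and the input pass to `L³` limits.  Unforced, datum-free
twin PROVED in tree: `Literature.Analysis.FluidPDE.Torus.isWeakEulerSolutionOn_of_inviscidLimit`.)
Why it might fail / sources: see the card. -/
theorem stub_periodicInviscidLimit :
    ∀ (f : 𝕋³ → E³) (τ c E : ℝ) (ν : ℕ → ℝ) (us : ℕ → ℝ → 𝕋³ → E³) (ps : ℕ → ℝ → 𝕋³ → ℝ)
      (w : ℝ → 𝕋³ → E³),
      Literature.Analysis.FunctionSpaces.Torus.IsSmooth f →
      Literature.Analysis.FunctionSpaces.Torus.IsDivFree f →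
      0 < τ → 0 < c →
      (∀ j, 0 < ν j) → Filter.Tendsto ν Filter.atTop (nhds 0) →
      (∀ j, Literature.Analysis.FunctionSpaces.Torus.IsClassicalNSSolutionOn Set.univ (ν j) (fun _ => f)
          (us j) (ps j) ∧ Function.Periodic (us j) τ) →
      (∀ j t, ∫ x, ‖us j t x‖ ^ 2 ≤ E) →
      (∀ j, c ≤ ∫ t in (0 : ℝ)..τ, MeasureTheory.integral MeasureTheory.volume
          (fun x => inner ℝ (f x) (us j t x))) →
      Function.Periodic w τ →
      MeasureTheory.AEStronglyMeasurable (Literature.Analysis.FunctionSpaces.Torus.stLift w)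
        (MeasureTheory.volume.restrict (Set.Ioo 0 τ ×ˢ Set.univ)) →
      Filter.Tendsto (fun j => ∫⁻ t in Set.Ioo 0 τ, ∫⁻ x, ‖us j t x - w t x‖ₑ ^ 3)
        Filter.atTop (nhds 0) →
      ∃ (u : ℝ → 𝕋³ → E³) (φ : ℕ → ℕ), StrictMono φ ∧ Function.Periodic u τ ∧
        (∀ T : ℝ, 0 < T →
          Literature.Analysis.FluidPDE.Torus.IsWeakNSSolutionForcedOn T 0 (fun _ => f) (u 0) u) ∧
        0 < ∫ t in (0 : ℝ)..τ, MeasureTheory.integral MeasureTheory.volume (fun x => inner ℝ (f x) (u t x)) ∧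
        Filter.Tendsto (fun j => MeasureTheory.lintegral
          (MeasureTheory.Measure.restrict MeasureTheory.volume (Set.Ioo 0 τ))
          (fun t => MeasureTheory.lintegral MeasureTheory.volume (fun x => ‖us (φ j) t x - u t x‖ₑ ^ 3)))
          Filter.atTop (nhds 0) := by
  sorry

/-! ## §2 By-name handles of the registered stubs (hypotheses of the composition; D-0027 §3.3 shape) -/

/-- Statement of registered stub 1 (`stub_loudTightFamily`), by name. -/
def Statement.stub_loudTightFamily : Prop :=
  type_of% _root_.Summit.AnomalousDissipation.AnomalousDissipation.Cruxes.EulerlimitThesisV2.Tight.stub_loudTightFamily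

/-- Statement of registered stub 2 (`stub_kolmogorovRieszPeriodicSlab`), by name. -/
def Statement.stub_kolmogorovRieszPeriodicSlab : Prop :=
  type_of% _root_.Summit.AnomalousDissipation.AnomalousDissipation.Cruxes.EulerlimitThesisV2.Tight.stub_kolmogorovRieszPeriodicSlab

/-- Statement of registered stub 3 (`stub_periodicInviscidLimit`), by name. -/
def Statement.stub_periodicInviscidLimit : Prop :=
  type_of% _root_.Summit.AnomalousDissipation.AnomalousDissipation.Cruxes.EulerlimitThesisV2.Tight.stub_periodicInviscidLimit

/-! ## §3 Composition (kernel-checked; no `sorry` outside the three stubs) -/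

/-- **The skeleton closes the crux BY NAME**:
`stub_loudTightFamily → stub_kolmogorovRieszPeriodicSlab → stub_periodicInviscidLimit →
EulerLimit.EulerlimitThesisV2`.  The family and `(f, τ)` come from stub 1; stub 2 (applied to the
velocities, jointly smooth by `IsClassicalNSSolutionOn.smooth_velocity`) returns an `L³((0,τ)×𝕋³)`
limit `w` along `φ₁`; stub 3 applied to the reindexed family returns the good representative `u`
along a further `φ₂`; the crux is witnessed by `(f, τ, u, ν ∘ φ₁ ∘ φ₂, us ∘ φ₁ ∘ φ₂, ps ∘ φ₁ ∘ φ₂)`. -/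
theorem EulerlimitThesisV2_of (h₁ : Statement.stub_loudTightFamily)
    (h₂ : Statement.stub_kolmogorovRieszPeriodicSlab) (h₃ : Statement.stub_periodicInviscidLimit) :
    EulerlimitThesisV2 := by
  obtain ⟨f, hf, hdf, hmf, τ, c, E, M, hτ, hc, ν, us, ps, hν, hν0, hcl, hE, hM, hin, heq⟩ := h₁
  -- stub 2: Kolmogorov–Riesz on the periodic slab
  obtain ⟨w, φ₁, hφ₁, hwper, hwmeas, hwlim⟩ :=
    h₂ τ M us hτ (fun j => (hcl j).1.smooth_velocity) (fun j => (hcl j).2) hM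
      (fun ε hε => by
        obtain ⟨δ, hδ, hδ'⟩ := heq ε hε
        exact ⟨δ, hδ, fun j s h hs hh => hδ' j s h hs hh⟩)
  -- the reindexed family
  have hν₁ : ∀ j, 0 < ν (φ₁ j) := fun j => hν (φ₁ j)
  have hν0₁ : Filter.Tendsto (fun j => ν (φ₁ j)) Filter.atTop (nhds 0) := hν0.comp hφ₁.tendsto_atTop
  -- stub 3: periodic same-force inviscid limit passage (forced, with datum)
  obtain ⟨u, φ₂, hφ₂, huper, hEuler, hinput, hL3⟩ :=
    h₃ f τ c E (fun j => ν (φ₁ j)) (fun j => us (φ₁ j)) (fun j => ps (φ₁ j)) w hf hdf hτ hc hν₁ hν0₁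
      (fun j => hcl (φ₁ j)) (fun j t => hE (φ₁ j) t) (fun j => hin (φ₁ j)) hwper hwmeas hwlim
  have hν0₂ : Filter.Tendsto (fun j => ν (φ₁ (φ₂ j))) Filter.atTop (nhds 0) :=
    hν0₁.comp hφ₂.tendsto_atTop
  exact ⟨f, hf, hdf, hmf, τ, u, hτ, huper, hEuler, hinput, fun j => ν (φ₁ (φ₂ j)),
    fun j => us (φ₁ (φ₂ j)), fun j => ps (φ₁ (φ₂ j)), fun j => hν (φ₁ (φ₂ j)), hν0₂,
    fun j => hcl (φ₁ (φ₂ j)), hL3⟩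

/-- The composition applied to the (sorried) stubs: the pipeline closes the crux by name (sorries
only upstream, inside the three registered stubs). -/
theorem EulerlimitThesisV2_via_stubs : EulerlimitThesisV2 :=
  EulerlimitThesisV2_of stub_loudTightFamily stub_kolmogorovRieszPeriodicSlab stub_periodicInviscidLimit

end Summit.AnomalousDissipation.AnomalousDissipation.Cruxes.EulerlimitThesisV2.Tight

end
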